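import Summits.Ventures.CertifiedArithmetic.LowPrec.GemmFirstRegimeWindowBase
import HarnessLib

/-!
# GEMM worst case LXIX-b — THE WINDOW past the first regime, part 2: the phase-0 bound

HONEST FRAMING: certified error envelopes and provably optimal rounding/accumulation schemes for
low-precision formats under stated cost models; every table by two implementations; no hardware or
vendor claims.

`phase0_bound`: along phase 0 (the steps `j₀, …, j₀+t-1`, arguments below `2T = 2^(m+2)`, from an
exact prefix ending at the even-or-small `P₀ = ŝ_{j₀}`), the potential invariant of `phase0_step`
(file LXIX-a) — `4Ψ'_i ≤ s'·Cap_i` with `s' = 2k - T ∈ (0, 8]`,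
`Ψ'_i = (T+2k)E_i - 2T(i-j₀) - (k/2)(L_i - s_i)`,
`Cap_i = c(ŝ_i) - c(P₀) + 2[(L_i - s_i) - (L₀ - s₀)] - 2p(ŝ_i) + 2p(P₀)`
(`2[(L_i - s_i) - (L₀ - s₀)] = 4W⁻_i`, four times the mass of the negative letters met) —
integrates, by `phase0_extract`, to
`4·[(T+2k)(ŝ_I - s_I) - 2T·t - k(L_I - s_I)] ≤ (2k - T)·T ≤ 8T` at `I = j₀ + t`.
This is the input of `window1_base_pos` in the window theorem (file LXIX-c, top level `2T`).
The bound is tight: the level-`2T` tie-chain family of file LXVIII has `Ψ_I = 2T` at `s' = 8`.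

References: [Higham2002, §4.2], [IEEE7542019, §4.3.1], [LangeRump2019], [BoldoEtAl2023, Thm 4.5].
-/

namespace Summit.Ventures.CertifiedArithmetic.LowPrec.Gemm

open Literature.ComputerArithmetic.FloatingPoint
open Literature.ComputerArithmetic.FloatingPoint.MiniFloat
open Finset

/-! ### The phase-0 bound -/

/-- THE PHASE-0 BOUND.  Steps `j₀, …, j₀+t-1` with arguments below `2T = 2^(m+2)`, an exact
prefix (`ŝ_{j₀} = s_{j₀}`, even or below `T`, at most `2T` in modulus), `T/2 < k ≤ T/2 + 4`:
`4·[(T+2k)(ŝ_I - s_I) - 2T·t - k(L_I - s_I)] ≤ (2k-T)·T` at `I = j₀ + t`. [cell] -/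
theorem phase0_bound {m j0 t : ℕ} {z acc : ℕ → ℤ} {k : ℤ} (hm : 2 ≤ m)
    (hs : (2 : ℤ) ^ (m + 1) < 2 * k) (hk8 : 2 * k ≤ 2 ^ (m + 1) + 8)
    (hacc : ∀ i, j0 ≤ i → i < j0 + t → acc (i + 1) = rneZ m (acc i + z (i + 1)))
    (hpre : acc j0 = sZ z j0) (hP0 : (acc j0).natAbs ≤ 2 ^ (m + 2))
    (hP0r : (2 : ℤ) ∣ acc j0 ∨ (acc j0).natAbs < 2 ^ (m + 1))
    (hlow : ∀ i, j0 ≤ i → i < j0 + t → (acc i + z (i + 1)).natAbs < 2 ^ (m + 2)) :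
    4 * ((2 ^ (m + 1) + 2 * k) * (acc (j0 + t) - sZ z (j0 + t)) - 2 * 2 ^ (m + 1) * t
        - k * (LZ z (j0 + t) - sZ z (j0 + t))) ≤ (2 * k - 2 ^ (m + 1)) * 2 ^ (m + 1) := by
  classical
  obtain ⟨T, hT⟩ : ∃ T : ℤ, T = 2 ^ (m + 1) := ⟨_, rfl⟩
  have hT8 : 8 ≤ T := by
    rw [hT]
    calc (8 : ℤ) = 2 ^ (2 + 1) := by norm_num
      _ ≤ 2 ^ (m + 1) := pow_le_pow_right₀ (by norm_num) (by omega)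
  have hT4 : 4 ∣ T := by
    obtain ⟨m', rfl⟩ : ∃ m', m = m' + 1 := ⟨m - 1, by omega⟩
    exact ⟨2 ^ m', by rw [hT]; ring⟩
  have hT0 : 0 ≤ T := by linarith
  have hk0 : 0 ≤ k := by linarith
  have h2T : ((2 ^ (m + 2) : ℕ) : ℤ) = 2 * T := by rw [hT]; push_cast; ring
  have hTN : ((2 ^ (m + 1) : ℕ) : ℤ) = T := by rw [hT]; push_cast; ring
  rw [← hT] at hs hk8 ⊢
  -- the signed excess beyond `±T` and the pending-half-phase flag
  obtain ⟨c, hc⟩ : ∃ c : ℤ → ℤ, c = fun x => x - max (-T) (min T x) := ⟨_, rfl⟩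
  have hcx : ∀ x, c x = x - max (-T) (min T x) := fun x => by rw [hc]
  obtain ⟨pe, hpe⟩ : ∃ pe : ℤ → ℤ,
      pe = fun x => if x % 4 = 2 ∧ T + 2 ≤ ((x.natAbs : ℕ) : ℤ) then 1 else 0 := ⟨_, rfl⟩
  have hpe0 : ∀ x, 0 ≤ pe x := fun x => by rw [hpe]; dsimp only; split_ifs <;> norm_num
  have hpe1 : ∀ x, pe x ≤ 1 := fun x => by rw [hpe]; dsimp only; split_ifs <;> norm_num
  have hpeA : ∀ x : ℤ, x % 4 = 2 → T + 2 ≤ x.natAbs → pe x = 1 := fun x h1 h2 => by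
    rw [hpe]; dsimp only; rw [if_pos ⟨h1, h2⟩]
  have hpeB : ∀ x : ℤ, 4 ∣ x → pe x = 0 := fun x h => by
    rw [hpe]; dsimp only; rw [if_neg]; rintro ⟨h1, -⟩; omega
  have hpeC : ∀ x : ℤ, (x.natAbs : ℤ) < T + 2 → pe x = 0 := fun x h => by
    rw [hpe]; dsimp only; rw [if_neg]; rintro ⟨-, h2⟩; omega
  -- the invariant along phase 0
  have key : ∀ r, r ≤ t →
      4 * (T + 2 * k) * (acc (j0 + r) - sZ z (j0 + r)) - 8 * T * r
          - 2 * k * (LZ z (j0 + r) - sZ z (j0 + r))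
        ≤ (2 * k - T) * (c (acc (j0 + r)) - c (acc j0)
            + 2 * ((LZ z (j0 + r) - sZ z (j0 + r)) - (LZ z j0 - sZ z j0))
            - 2 * pe (acc (j0 + r)) + 2 * pe (acc j0))
      ∧ ((2 : ℤ) ∣ acc (j0 + r) ∨ (acc (j0 + r)).natAbs < 2 ^ (m + 1))
      ∧ (acc (j0 + r)).natAbs ≤ 2 ^ (m + 2)
      ∧ LZ z j0 - sZ z j0 ≤ LZ z (j0 + r) - sZ z (j0 + r) := by
    intro r
    induction r with
    | zero =>
        intro _
        refine ⟨?_, by simpa using hP0r, by simpa using hP0, by simp⟩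
        simp only [hpre, sub_self, mul_zero, Nat.cast_zero, zero_sub, add_zero]
        have h1 := abs_sZ_le_LZ z j0
        have h2 := le_abs_self (sZ z j0)
        have := mul_nonneg hk0 (show 0 ≤ LZ z j0 - sZ z j0 by linarith)
        linarith
    | succ r ih =>
        intro hr
        obtain ⟨ih1, ih2, -, ih4⟩ := ih (by omega)
        have hi1 : j0 ≤ j0 + r := by omega
        have hi2 : j0 + r < j0 + t := by omega
        have hst := hacc (j0 + r) hi1 hi2
        have hVr := hlow (j0 + r) hi1 hi2
        obtain ⟨h1, h2, h3⟩ := level0_step (m := m) hVr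
        rw [← hst] at h1 h2 h3
        have hstep := phase0_step (k := k) (pa := pe (acc (j0 + r)))
          (pa' := pe (acc (j0 + r + 1))) (zn := max (-z (j0 + r + 1)) 0) hT8 hT4 hs hk8 h1
          (fun hne => by
            obtain ⟨q1, q2, q3⟩ := h2 hne
            exact ⟨by rw [← hTN]; exact_mod_cast q1, q2, q3⟩)
          (by
            rcases ih2 with h | h
            · exact Or.inl h
            · right; rw [← hTN]; exact_mod_cast h)
          (hcx _) (hcx _) (hpe0 _) (hpeA _) (hpe1 _) (hpeB _) rfl
        have hzz : (((z (j0 + r + 1)).natAbs : ℕ) : ℤ)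
            = z (j0 + r + 1) + 2 * max (-z (j0 + r + 1)) 0 := by omega
        refine ⟨?_, h3, ?_, ?_⟩
        · rw [show j0 + (r + 1) = j0 + r + 1 by omega, sZ_succ, LZ_succ,
            show ((r + 1 : ℕ) : ℤ) = (r : ℤ) + 1 by push_cast; ring, hzz]
          linarith [ih1, hstep]
        · rw [show j0 + (r + 1) = j0 + r + 1 by omega]
          have := hVr; omega
        · rw [show j0 + (r + 1) = j0 + r + 1 by omega, sZ_succ, LZ_succ]
          have : (0 : ℤ) ≤ max (-z (j0 + r + 1)) 0 := le_max_right _ _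
          linarith
  obtain ⟨hinv, -, hI, hAD⟩ := key t le_rfl
  -- extraction
  have hIT : (((acc (j0 + t)).natAbs : ℕ) : ℤ) ≤ 2 * T := by
    rw [← h2T]; exact_mod_cast hI
  have hcI : c (acc (j0 + t)) ≤ T := by rw [hcx]; omega
  have hcP : -c (acc j0) + 2 * pe (acc j0) ≤ 2 * max (-T - acc j0) 0 := by
    rw [hcx]
    by_cases hbig : T + 2 ≤ ((acc j0).natAbs : ℤ)
    · have := hpe1 (acc j0); omega
    · rw [hpeC _ (by omega)]; omega
  have hmxD : max (-T - acc j0) 0 ≤ LZ z j0 - sZ z j0 := by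
    rw [← hpre]
    have h1 := abs_sZ_le_LZ z j0
    have h2 := neg_abs_le (sZ z j0)
    have h3 := le_abs_self (sZ z j0)
    rw [← hpre] at h1 h2 h3
    exact max_le (by linarith) (by linarith)
  have := phase0_extract (t := (t : ℤ)) hinv hcI (hpe0 _) hcP (le_max_right _ _) hmxD hAD
    (by linarith) (by linarith) hk0
  linarith

end Summit.Ventures.CertifiedArithmetic.LowPrec.Gemm
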